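import Mathlib
import Summits.Schanuel.Schanuel.Theses.RigidCore
import Summits.Schanuel.Schanuel.Theorems.AclSubsetLogFreeCore.Negative.LogFreeCoreObjects
import Summits.Schanuel.Schanuel.Theorems.AclSubsetLogFreeCore.Negative.ExpAclDefinability
import Literature.Barriers.Schanuel.AlgebraicIndependenceOfLogarithms
import Literature.Barriers.Schanuel.LargeTranscendenceDegree
import Literature.NumberTheory.Transcendental.SchanuelEclEmptyProofs

/-!
# Line `kernel-tower-relative-lw` (route `RigidCore`): calibration of Stub 2 — `RelLW_{m+1}` at `m = 0`, `u = (e^π)` yields `π, e^π, e^{e^π}` algebraically independent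

Registered calibration stub `stub_expExpPi_of_relLWStep` of line `kernel-tower-relative-lw` of
crux `stmt-Schanuel-0970` (`Summit.Schanuel.Schanuel.Theses.RigidCore.SchanuelOnLogFreeCore`),
signature verbatim.  It is OFF the path to `SchanuelOnLogFreeCore_of`: it is the census
certificate that the second relative Lindemann–Weierstrass layer of the line,

  `RelLW_{m+1}`: for `u ⊂ L_{m+1} = stage (m+1)` that is `ℚ`-linearly independent modulo
  `L_m = stage m`, the family `e^u` is algebraically independent over `L_{m+1}`

(the tree tower `stage 0 = ℚ(2πi)^{ralg}`, `stage (m+1) = ℚ(stage m ∪ exp (stage m))^{ralg}` of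
`Theorems/AclSubsetLogFreeCore/Negative/LogFreeCoreObjects.lean`), is OPEN already at its first
instance `m = 0`, `r = 1`, `u = (e^π)`, independently of the level-`0` layer `RelLW₀`:

* the HYPOTHESIS of that instance holds unconditionally: `π = 2πi/(2i) ∈ stage 0`, so
  `e^π ∈ stage 1` (`ExpExpPi.exp_pi_mem_stage_succ`); and `(e^π)` is `ℚ`-independent modulo
  `span_ℚ (stage 0) = stage 0` because `e^π ∉ stage 0 ≤ ℚ(π)^{ralg}` — Nesterenko's `π ⊥ e^π`
  (tree theorem `nesterenko_holds`, here through `exp_pi_not_mem_Kpi`;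
  `ExpExpPi.linearIndependent_mkQ_exp_pi`);
* the CONCLUSION "`e^{e^π}` is transcendental over `stage 1 ⊇ ℚ(π, e^π)`" stacks by the tower
  law on `trdeg ℚ(π, e^π) = 2` (Nesterenko again, `algebraicIndependent_pi_exp_pi`) to
  `trdeg ℚ(π, e^π, e^{e^π}) = 3`, i.e. `π, e^π, e^{e^π}` are algebraically independent over `ℚ`
  — a prediction of Schanuel's conjecture at `x = (iπ, π, e^π)` that is open (even the
  irrationality of `e^{e^π}` is open).

So `stub_expExpPi_of_relLWStep : RelLWstep → AlgebraicIndependent ℚ ![π, e^π, e^{e^π}]` is a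
sorry-free IMPLICATION; it is fed nothing, closes nothing and claims no instance of `RelLWstep`.
Everything here is proved; the only transcendence input is the PROVED tree theorem
`nesterenko_holds` (via `exp_pi_not_mem_Kpi`, `algebraicIndependent_pi_exp_pi`).

## References

* [Nesterenko1996SbMath] Yu. V. Nesterenko, *Modular functions and transcendence questions*,
  Sb. Math. 187 (1996) 1319–1348, Theorem 1 (`π, e^π, Γ(1/4)` algebraically independent;
  tree theorem `nesterenko_holds`).
* [Kirby2010] J. Kirby, *Exponential algebraicity in exponential fields*, Bull. Lond. Math.
  Soc. 42 (2010) 879–890, arXiv:0810.4285, Prop. 7.2 (the e/a-chain bookkeeping behind the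
  tower `stage`).
-/

noncomputable section

namespace Summit.Schanuel.Schanuel.Theorems.RigidCore

open IntermediateField Complex
open Summit.Schanuel.Schanuel.Theorems.AclSubsetLogFreeCore.Negative

namespace ExpExpPi

/-! ### The hypothesis of `RelLW₁` at `u = (e^π)` holds unconditionally -/

/-- `π ∈ stage m` for every level `m` of the tower: `i ∈ stage 0` (algebraic over `ℚ`,
`stage 0` is relatively algebraically closed in `ℂ`), so `π = 2πi · (2i)⁻¹ ∈ stage 0 ≤ stage m`.
[folklore] -/
theorem pi_mem_stage (m : ℕ) : (Real.pi : ℂ) ∈ stage m := by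
  refine monotone_stage (Nat.zero_le m) ?_
  have hI : Complex.I ∈ stage 0 := by
    have hIa : IsAlgebraic ℚ Complex.I :=
      IsAlgebraic.of_pow two_pos (by rw [Complex.I_sq]; exact isAlgebraic_one.neg)
    exact stage_closed 0 _ (hIa.tower_top (L := ↥(stage 0)))
  have h2I : (2 * Complex.I : ℂ) ∈ stage 0 :=
    mul_mem (by exact_mod_cast IntermediateField.natCast_mem (stage 0) 2) hI
  have h2I0 : (2 * Complex.I : ℂ) ≠ 0 := mul_ne_zero two_ne_zero Complex.I_ne_zero
  have e : (Real.pi : ℂ) = 2 * (Real.pi : ℂ) * Complex.I * (2 * Complex.I)⁻¹ := by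
    rw [eq_mul_inv_iff_mul_eq₀ h2I0]
    ring
  rw [e]
  exact mul_mem two_pi_I_mem_stage_zero (inv_mem h2I)

/-- `e^π ∈ stage (m+1)` for every `m` (`exp` maps `stage m ∋ π` into `stage (m+1)`); at `m = 0`:
`e^π ∈ L₁`. [folklore] -/
theorem exp_pi_mem_stage_succ (m : ℕ) : Complex.exp (Real.pi : ℂ) ∈ stage (m + 1) :=
  exp_mem_stage_succ (pi_mem_stage m)

/-- `e^π ∉ stage 0`: an element of `stage 0 = ℚ(2πi)^{ralg}` is algebraic over `ℚ(2πi) ≤ Kpi =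
ℚ(π)^{ralg}`, hence lies in `Kpi` — but `e^π ∉ Kpi` (Nesterenko). [cite: Nesterenko1996SbMath] -/
theorem exp_pi_not_mem_stage_zero : Complex.exp (Real.pi : ℂ) ∉ stage 0 := by
  intro h
  have h' : Complex.exp (Real.pi : ℂ) ∈
      relAlg (IntermediateField.adjoin ℚ {(2 * ↑Real.pi * Complex.I : ℂ)}) := h
  rw [mem_relAlg_iff] at h'
  have hle : IntermediateField.adjoin ℚ {(2 * ↑Real.pi * Complex.I : ℂ)} ≤ Kpi :=
    adjoin_le_iff.mpr (Set.singleton_subset_iff.mpr two_pi_I_mem_Kpi)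
  exact exp_pi_not_mem_Kpi (relAlg_closed _ _ (isAlgebraic_of_le hle h'))

/-- The `ℚ`-span of (the carrier of) a level of the tower is that level. [folklore] -/
theorem mem_stage_of_mem_span {m : ℕ} {a : ℂ} (ha : a ∈ Submodule.span ℚ (stage m : Set ℂ)) :
    a ∈ stage m := by
  have hle : Submodule.span ℚ (stage m : Set ℂ) ≤ Subalgebra.toSubmodule (stage m).toSubalgebra :=
    Submodule.span_le.mpr fun x hx => hx
  exact hle ha

/-- The one-element family `(e^π)` is `ℚ`-linearly independent modulo `span_ℚ (stage 0)`,
i.e. `e^π ∉ span_ℚ (stage 0) = stage 0` (Nesterenko). [cite: Nesterenko1996SbMath] -/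
theorem linearIndependent_mkQ_exp_pi :
    LinearIndependent ℚ
      ((Submodule.span ℚ (stage 0 : Set ℂ)).mkQ ∘ fun _ : Fin 1 => Complex.exp (Real.pi : ℂ)) := by
  rw [linearIndependent_unique_iff]
  simp only [Function.comp_apply, ne_eq, Submodule.mkQ_apply, Submodule.Quotient.mk_eq_zero]
  exact fun h => exp_pi_not_mem_stage_zero (mem_stage_of_mem_span h)

/-! ### Transcendence-degree bookkeeping -/

/-- `ℚ(π, e^π) ≤ stage (m+1)` for every `m`; at `m = 0`: `ℚ(π, e^π) ≤ L₁`. [folklore] -/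
theorem adjoin_pi_exp_pi_le_stage_succ (m : ℕ) :
    IntermediateField.adjoin ℚ {(Real.pi : ℂ), Complex.exp (Real.pi : ℂ)} ≤ stage (m + 1) := by
  rw [adjoin_le_iff]
  rintro a (rfl | ha)
  · exact pi_mem_stage (m + 1)
  · rw [Set.mem_singleton_iff.mp ha]
    exact exp_pi_mem_stage_succ m

/-- `2 ≤ trdeg ℚ ℚ(π, e^π)` (Nesterenko: `π, e^π` algebraically independent).
[cite: Nesterenko1996SbMath] -/
theorem two_le_trdeg_adjoin_pi_exp_pi :
    (2 : Cardinal) ≤ Algebra.trdeg ℚ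
      ↥(IntermediateField.adjoin ℚ {(Real.pi : ℂ), Complex.exp (Real.pi : ℂ)}) := by
  set F : IntermediateField ℚ ℂ :=
    IntermediateField.adjoin ℚ {(Real.pi : ℂ), Complex.exp (Real.pi : ℂ)}
  have hmem : ∀ j : Fin 2, ![(Real.pi : ℂ), Complex.exp (Real.pi : ℂ)] j ∈ F := by
    intro j
    refine subset_adjoin ℚ _ ?_
    fin_cases j <;> simp
  let f : Fin 2 → ↥F := fun j => ⟨![(Real.pi : ℂ), Complex.exp (Real.pi : ℂ)] j, hmem j⟩
  have hf : AlgebraicIndependent ℚ f :=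
    AlgebraicIndependent.of_comp F.val algebraicIndependent_pi_exp_pi
  simpa using hf.cardinalMk_le_trdeg

end ExpExpPi

/-- **Calibration of Stub 2 (`RelLW_{m+1}`) of line `kernel-tower-relative-lw`.** If
exponentials of tuples from `stage (m+1)` that are `ℚ`-linearly independent modulo `stage m`
are algebraically independent over `stage (m+1)` (for all `m`), then `π, e^π, e^{e^π}` are
algebraically independent over `ℚ`.  Proof: the instance `m = 0, r = 1, u = (e^π)` has an
unconditionally true hypothesis (`e^π ∈ stage 1`; `e^π ∉ stage 0` by Nesterenko), so `e^{e^π}`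
is transcendental over `stage 1 ⊇ ℚ(π, e^π)`; with `trdeg ℚ(π, e^π) = 2` (Nesterenko) the tower
law gives `trdeg ℚ(π, e^π, e^{e^π}) ≥ 3`.  The hypothesis is an open conjecture (a consequence of
Schanuel's conjecture); the conclusion is open; this implication closes nothing. -/
theorem stub_expExpPi_of_relLWStep :
    (∀ (m r : ℕ) (u : Fin r → ℂ), (∀ i, u i ∈ stage (m + 1)) →
      LinearIndependent ℚ ((Submodule.span ℚ (stage m : Set ℂ)).mkQ ∘ u) →
        AlgebraicIndependent (↥(stage (m + 1))) (fun i => Complex.exp (u i))) →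
      AlgebraicIndependent ℚ
        ![(Real.pi : ℂ), Complex.exp (Real.pi : ℂ), Complex.exp (Complex.exp (Real.pi : ℂ))] := by
  intro hstep
  -- Stub 2 at `m = 0`, `r = 1`, `u = (e^π)`: `e^{e^π}` is transcendental over `stage 1`
  have hE : AlgebraicIndependent (↥(stage (0 + 1)))
      (fun _ : Fin 1 => Complex.exp (Complex.exp (Real.pi : ℂ))) :=
    hstep 0 1 (fun _ => Complex.exp (Real.pi : ℂ)) (fun _ => ExpExpPi.exp_pi_mem_stage_succ 0)
      ExpExpPi.linearIndependent_mkQ_exp_pi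
  -- descend to `F = ℚ(π, e^π) ≤ stage 1`
  set F : IntermediateField ℚ ℂ :=
    IntermediateField.adjoin ℚ {(Real.pi : ℂ), Complex.exp (Real.pi : ℂ)}
  have hE' :
      AlgebraicIndependent (↥F) (fun _ : Fin 1 => Complex.exp (Complex.exp (Real.pi : ℂ))) :=
    Literature.NumberTheory.Transcendental.AlgebraicIndependent.of_intermediateField_le
      (ExpExpPi.adjoin_pi_exp_pi_le_stage_succ 0) hE
  set T : Set ℂ := Set.range (fun _ : Fin 1 => Complex.exp (Complex.exp (Real.pi : ℂ)))
  have hb : (1 : Cardinal) ≤ Algebra.trdeg (↥F) ↥(adjoin (↥F) T) := by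
    let f : Fin 1 → ↥(adjoin (↥F) T) := fun j =>
      ⟨Complex.exp (Complex.exp (Real.pi : ℂ)), subset_adjoin (↥F) T ⟨j, rfl⟩⟩
    have hf : AlgebraicIndependent (↥F) f := AlgebraicIndependent.of_comp (adjoin (↥F) T).val hE'
    simpa using hf.cardinalMk_le_trdeg
  -- the tower law: `2 + 1 ≤ trdeg ℚ(π, e^π, e^{e^π})`
  have h3 : (2 : Cardinal) + 1 ≤
      Algebra.trdeg ℚ ↥(adjoin ℚ ({(Real.pi : ℂ), Complex.exp (Real.pi : ℂ)} ∪ T)) :=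
    Literature.NumberTheory.Transcendental.add_le_trdeg_adjoin_union _ T
      ExpExpPi.two_le_trdeg_adjoin_pi_exp_pi hb
  set l : Fin 3 → ℂ :=
    ![(Real.pi : ℂ), Complex.exp (Real.pi : ℂ), Complex.exp (Complex.exp (Real.pi : ℂ))] with hl
  have hle :
      adjoin ℚ ({(Real.pi : ℂ), Complex.exp (Real.pi : ℂ)} ∪ T) ≤ adjoin ℚ (Set.range l) := by
    rw [adjoin_le_iff]
    rintro a ((rfl | ha) | ⟨j, rfl⟩)
    · exact subset_adjoin ℚ _ ⟨0, by simp [hl]⟩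
    · rw [Set.mem_singleton_iff.mp ha]
      exact subset_adjoin ℚ _ ⟨1, by simp [hl]⟩
    · exact subset_adjoin ℚ _ ⟨2, by simp [hl]⟩
  have h3' : ((3 : ℕ) : Cardinal) ≤ Algebra.trdeg ℚ ↥(adjoin ℚ (Set.range l)) := by
    have : ((3 : ℕ) : Cardinal) = (2 : Cardinal) + 1 := by norm_num
    rw [this]
    exact h3.trans (Literature.Barriers.Schanuel.trdeg_mono hle)
  exact Literature.Barriers.Schanuel.algebraicIndependent_of_le_trdeg_adjoin l h3'

end Summit.Schanuel.Schanuel.Theorems.RigidCore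

end
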